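/-
Copyright (c) 2026 the pub-hodgecm-mathlib formalisation cell (harness21).  Prover seat hodgecm-mathlib-F0P3-p01 (g32), Track A «(D-RAM) FOUR-FRAME», unit U2H, census leaf
(ρ2b′-X) — T5b «toric level census, type RamK»: `𝒪_Fˣ ⊆ N_{M∕K♮}(𝒪_Mˣ)` with the unramified third field handed over as a valued field (part II of ★ p857325).  2026-09-04.
-/
import Literature.NumberTheory.LocalFields.QuadraticDatumNormsOfDoublyFixedUnits    -- ★ p857325 (this seat): ρ-averaging, `exists_mul_map_eq_of_fixed_fixed_of_isRamifiedQuadraticDatum`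
import Literature.NumberTheory.LocalFields.UnramifiedQuadraticNormSurjective        -- ★ Serre V §2 Prop. 3: `exists_mul_map_eq_of_finite_residueField` (complete local ring, unit-moving involution)
import Literature.NumberTheory.LocalFields.WildQuadraticDatumUnitDepthIndex          -- ★ p857227: `exists_ringHom_integer`, `ringHom_integer_involutive`, `coe_ringHom_integer_sub`
import HarnessLib

/-!
# The base units are hermitian norms, the third field handed over: `𝒪_Fˣ ⊆ N_{M∕K♮}(𝒪_Mˣ)` from Serre V §2 Prop. 3 on an UNRAMIFIED `K′ ≅ K♮`
(Serre, *Local Fields* Ch. V §2 Prop. 3 (unit norms of an unramified extension), §3 Cor. 3; Neukirch, *Algebraic Number Theory* Ch. V (1.3)–(1.4))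

Topic `NumberTheory/LocalFields`; namespace `Literature.NumberTheory.LocalFields.WildQuadraticDatum` (part II of ★ `QuadraticDatumNormsOfDoublyFixedUnits`).  THEOREMS ONLY (no
definition, no instance, no notation, no named fact, no `sorry`); kernel lane `--supports stmt-HodgeConjecture-24833` (count-neutral).  Cell `pub/hodgecm-mathlib` (D-0151), crux
H413, Track A, unit U2H, census leaf (ρ2b′-X): type RamK of the toric census (hodgecm-mathlib-F0P3-p01 (g32) T5b): ★ p857325 reduced «every `(ρ,Θ)`-fixed unit is a norm `zΘz`»
to the unramified unit-norm surjectivity of the third field `K♮ ∕ F`.  With the third field HANDED OVER as a valued field `K′` (device of ★ `QuadraticOrderTorusIndices` §2,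
LH4-p08 (g4): an embedding `jK : K′ →+* M` onto `Fix Θ` with `jK ∘ σ′ = ρ ∘ jK`; in type RamK `|jK x| = |x|²`), that surjectivity IS ★ `exists_mul_map_eq_of_finite_residueField`
on the complete local ring `𝒪[K′]` with the unit-moving involution `σ′` (`|α′ − σ′α′| = 1`):
* `exists_theta_fixed_mul_map_eq_of_thirdField` — every `(ρ,Θ)`-fixed unit `f` of `M` is `g·ρ(g)` for a `Θ`-fixed unit `g` (`g = jK s`, `s·σ′s = jK⁻¹ f`);
* **`exists_mul_map_eq_of_fixed_fixed_of_thirdField`** — hence (★ p857325) every `(ρ,Θ)`-fixed unit is a hermitian norm `z·Θz`: the token `hFN` of ★ `QuadraticOrderNormDepthIndexTwo`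
  DISCHARGED inside the two-field frame.
HONEST LABEL: HC_CM is proved only modulo the 7 printed citations (2 remaining named inputs: hLiu418 = stmt-HodgeConjecture-24832, h413 = stmt-HodgeConjecture-24833) until rung 0
closes; unconditional local algebra, count-neutral.

## References
* [Serre1979] J.-P. Serre, *Local Fields*, GTM 67 (1979): Ch. V §2 Prop. 3 (`U_K = N U_L` for an unramified extension), Ch. V §3 Cor. 3.
* [NeukirchANT1999] J. Neukirch, *Algebraic Number Theory*, Grundlehren 322 (1999): Ch. V (1.3)–(1.4).
-/

set_option autoImplicit false

open WithZero IsLocalRing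
open scoped Valued
open Literature.NumberTheory.Automorphic.UnitaryThreeFourFrame
open Literature.NumberTheory.LocalFields.UnramifiedQuadraticNorm

namespace Literature.NumberTheory.LocalFields.WildQuadraticDatum

section ThirdField

variable {K K' : Type} [Field K] [Valued K ℤᵐ⁰] [Field K'] [Valued K' ℤᵐ⁰] {ρ Θ : K →+* K} {σ' : K' →+* K'} {α' π' : K'}

/-- `x² = 1 ↔ x = 1` in `ℤᵐ⁰`. [folklore] -/
private theorem sq_eq_one_iff_withZero' (x : ℤᵐ⁰) : x ^ 2 = 1 ↔ x = 1 := by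
  refine ⟨fun h => ?_, fun h => by rw [h, one_pow]⟩
  rcases eq_or_ne x 0 with rfl | h0
  · rw [zero_pow (by norm_num : (2 : ℕ) ≠ 0)] at h; exact absurd h zero_ne_one
  · have h' := congrArg log h
    rw [log_pow, log_one, nsmul_eq_mul] at h'
    have hlog : log x = 0 := by push_cast at h'; omega
    rw [← exp_log h0, hlog, exp_zero]

/-- **THE UNRAMIFIED SURJECTIVITY OF THE THIRD FIELD, READ IN `M`**: with `K′` complete, finite residue field, `σ′` an involution moving the integer `α′` by a unit, and
`jK : K′ →+* M` onto `Fix Θ` with `|jK x| = |x|²` and `jK ∘ σ′ = ρ ∘ jK`, every unit of `M` fixed by `ρ` and `Θ` is `g·ρ(g)` for a `Θ`-fixed unit `g` (★ Serre V §2 Prop. 3 on `𝒪[K′]`).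
[cite: Serre1979, Ch. V §2 Prop. 3] -/
theorem exists_theta_fixed_mul_map_eq_of_thirdField [CompleteSpace K'] [Finite 𝓀[K']]
    (hσ' : ∀ x, σ' (σ' x) = x) (hvσ' : ∀ x, Valued.v (σ' x) = Valued.v x) (hα'1 : Valued.v α' ≤ 1) (hα' : Valued.v (α' - σ' α') = 1)
    (hπ' : Valued.v π' = exp (-1 : ℤ))
    (jK : K' →+* K) (hjv : ∀ x, Valued.v (jK x) = Valued.v x ^ 2) (hjΘ : ∀ x, Θ (jK x) = jK x) (hjfix : ∀ z : K, Θ z = z → ∃ x, jK x = z)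
    (hjσ : ∀ x, jK (σ' x) = ρ (jK x)) {f : K} (hρf : ρ f = f) (hΘf : Θ f = f) (hf : Valued.v f = 1) :
    ∃ g : K, Θ g = g ∧ Valued.v g = 1 ∧ g * ρ g = f := by
  haveI : IsAdicComplete 𝓂[K'] 𝒪[K'] := Literature.NumberTheory.LocalFields.isAdicComplete_valuedInteger_of_completeSpace hπ'
  obtain ⟨f', hf'⟩ := hjfix f hΘf
  -- `f′` is a `σ′`-fixed unit of `K′`
  have hf'1 : Valued.v f' = 1 := (sq_eq_one_iff_withZero' _).1 (by rw [← hjv, hf', hf])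
  have hσ'f' : σ' f' = f' := jK.injective (by rw [hjσ, hf', hρf])
  -- Serre V §2 Prop. 3 on `𝒪[K′]`
  obtain ⟨σO, hσO⟩ := exists_ringHom_integer hvσ'
  have hσOO := ringHom_integer_involutive hσ' hσO
  have hunit : ∀ z : 𝒪[K'], IsUnit z ↔ Valued.v (z : K') = 1 := fun z =>
    (Valuation.integer.integers (Valued.v (R := K'))).isUnit_iff_valuation_eq_one
  have ha : IsUnit (σO ⟨α', hα'1⟩ - ⟨α', hα'1⟩) := by
    rw [hunit, coe_ringHom_integer_sub hσO, Valuation.map_sub_swap]; exact hα'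
  obtain ⟨s, hs⟩ := exists_mul_map_eq_of_finite_residueField σO hσOO ha ⟨f', hf'1.le⟩ ((hunit _).2 hf'1) (Subtype.ext (by rw [hσO]; exact hσ'f'))
  have hs' : (s : K') * σ' s = f' := by
    have := congrArg (fun z : 𝒪[K'] => (z : K')) hs
    simpa [hσO] using this
  have hs1 : Valued.v (s : K') = 1 := by
    have h2 : Valued.v (s : K') * Valued.v (s : K') = 1 := by
      have := congrArg Valued.v hs'; rwa [map_mul, hvσ', hf'1] at this
    exact (sq_eq_one_iff_withZero' _).1 (by rw [pow_two]; exact h2)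
  refine ⟨jK s, hjΘ _, by rw [hjv, hs1, one_pow], ?_⟩
  rw [← hjσ, ← map_mul, hs', hf']

/-- **`𝒪_Fˣ ⊆ N_{M∕K♮}(𝒪_Mˣ)` IN THE TWO-FIELD FRAME** (type RamK): every unit of `M` fixed by `ρ` and `Θ` is a hermitian norm `z·Θz` — ★ p857325's ρ-averaging with its surjectivity
hypothesis discharged by `exists_theta_fixed_mul_map_eq_of_thirdField`.  This is the `hFN` token of ★ `QuadraticOrderNormDepthIndexTwo.relIndex_normDepth_eq_ite_of_index_two`.
[cite: Serre1979, Ch. V §2 Prop. 3] [cite: Serre1979, Ch. V §3 Cor. 3] [cite: NeukirchANT1999, Ch. V (1.3)–(1.4)] -/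
theorem exists_mul_map_eq_of_fixed_fixed_of_thirdField [CompleteSpace K] [Finite 𝓀[K]] [CompleteSpace K'] [Finite 𝓀[K']]
    (hρρ : ∀ x, ρ (ρ x) = x) (hvρ : ∀ x, Valued.v (ρ x) = Valued.v x) (hΘρ : ∀ x, Θ (ρ x) = ρ (Θ x))
    {ϖ : K} {d t : ℕ} (hD : IsRamifiedQuadraticDatum Θ ϖ d t)
    (hσ' : ∀ x, σ' (σ' x) = x) (hvσ' : ∀ x, Valued.v (σ' x) = Valued.v x) (hα'1 : Valued.v α' ≤ 1) (hα' : Valued.v (α' - σ' α') = 1)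
    (hπ' : Valued.v π' = exp (-1 : ℤ))
    (jK : K' →+* K) (hjv : ∀ x, Valued.v (jK x) = Valued.v x ^ 2) (hjΘ : ∀ x, Θ (jK x) = jK x) (hjfix : ∀ z : K, Θ z = z → ∃ x, jK x = z)
    (hjσ : ∀ x, jK (σ' x) = ρ (jK x)) {f : K} (hρf : ρ f = f) (hΘf : Θ f = f) (hf : Valued.v f = 1) : ∃ z : K, z * Θ z = f :=
  exists_mul_map_eq_of_fixed_fixed_of_isRamifiedQuadraticDatum hρρ hvρ hΘρ hD
    (fun _ hρg hΘg hg => exists_theta_fixed_mul_map_eq_of_thirdField hσ' hvσ' hα'1 hα' hπ' jK hjv hjΘ hjfix hjσ hρg hΘg hg) hρf hΘf hf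

end ThirdField

end Literature.NumberTheory.LocalFields.WildQuadraticDatum
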